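import Literature.Probability.RandomPlanarGeometry.SAWPatternTheorem
import Literature.Probability.RandomPlanarGeometry.SAWPositiveWalks
import HarnessLib

/-!
# Dimension transfer for the connective constant: `μ(ℤ^{d+1}) ≥ Φ(μ(ℤ^d))`, strictly

Topic `Literature/Probability/RandomPlanarGeometry` vocabulary (`SAWCount.lean`: the vertex-function model
`Zd.saws d n` of the `n`-step self-avoiding walks on `ℤ^d` from `0`, `#Zd.saws d n = cₙ⁽ᵈ⁾ = Zd.count d n`,
`Zd.connectiveConstant d = μ(d) = infₙ (cₙ⁽ᵈ⁾)^{1/n}`). Authorship: proofs by the lane «pcv-sawmu» seat a-p6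
(gen 1/2, 2026-08-22), route a-idea-2 ROUTES §R2 (extra X10, PLAN amendment 10); ported to the tree vocabulary
(namespace `…SAW.Zd.DimTransfer`) by a-p5 gen 4. Relation to `SAWDimensionGap.lean` (a-p3,
`Zd.connectiveConstant_add_one_le : μ(d) + 1 ≤ μ(d+1)`, `Zd.connectiveConstant_lt_succ`,
`Zd.strictMono_connectiveConstant`, by interleaving): the transfer `Φ(μ) ≥ μ + 1` below CONTAINS the unit gap
(`add_one_le_Phi`), so those statements are corollaries of `phi_connectiveConstant_le`; they are not
re-declared here.

## The argument

*Lifts.* Fix a word `w ∈ {H, U, D}ⁿ` in which `U` is never immediately followed by `D` nor `D` by `U`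
("admissible": every maximal run of vertical letters is monotone), with `m` letters `H`, and an `m`-step
self-avoiding walk `ω` on `ℤ^d`. The walk on `ℤ^{d+1} = ℤ × ℤ^d` which at a letter `H` performs the next
step of `ω` and at a letter `U` / `D` steps `+e₀` / `-e₀` is self-avoiding: two times with the same base
point are separated by vertical letters only, i.e. lie in one monotone vertical run, so their heights
differ. The pair `(w, ω)` can be read off the lift. Hence the FINITE FORM

  `Σ_{w admissible of length n} c⁽ᵈ⁾_{#H(w)} ≤ c⁽ᵈ⁺¹⁾ₙ`

(grouping the words by `m = #H(w)` and by the lengths `ℓ₀, …, ℓ_m` of the vertical runs between base steps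
gives `Σ_{m + Σℓᵢ = n} c⁽ᵈ⁾_m ∏ᵢ (2 if ℓᵢ ≥ 1 else 1)`; generating function `R(x)·C_d(xR(x))`,
`R = (1+x)/(1-x)`). For `d = 1` the lifts of the two directed half-lines are exactly the partially
directed walks of `ℤ²` (Temperley 1956; Janse van Rensburg 2015, eq. (4.197): growth constant `1 + √2`).

*Growth, limit-free.* With `cₘ ≥ μ(d)^m` the left side is at least `Gₙ(μ) := Σ_{w admissible} μ^{#H(w)}`
(`μ = μ(d)`), and the first-letter decomposition gives `G₀ = 1`, `G₁ = μ + 2`,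
`G_{n+2} = (μ+1) G_{n+1} + μ Gₙ`; since `Φ = Φ(μ) := (μ + 1 + √(μ² + 6μ + 1))/2` satisfies
`Φ² = (μ+1)Φ + μ` and `Φ ≤ μ + 2`, a two-step induction gives `Φⁿ ≤ Gₙ ≤ c⁽ᵈ⁺¹⁾ₙ` for EVERY `n`, whence
`Φ(μ(d)) ≤ μ(d+1)` straight from the definition of `μ(d+1)` as an infimum (no Fekete).

*Strictness.* Kesten's pattern theorem is in the tree for the cube pattern `(V, Q)`, `V = N³ESENES³`
(`Zd.thm723`, Madras–Slade Theorem 7.2.3 as used in Theorem 7.3.2), with `E = +e₀` — the fresh direction of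
the lifts. The segment `E S E` of `V` would make the base walk step `S` then `N` consecutively, i.e. return
to a site: so NO lift has an occurrence of `(V, Q)`, all lifts belong to the exponentially small class of
`thm723`, and `Φ(μ(d+1)) ≤ (1-ε) μ(d+2) < μ(d+2)` for every `d` (total dimension `≥ 2`; for total dimension
`1` equality holds: `μ(ℤ¹) = 1 = Φ(μ(ℤ⁰)) = Φ(0)`). The `ε` is Kesten's, ineffective.

*Corollaries.* `Φ(μ) - μ = 1 + 2μ/(√(μ²+6μ+1) + μ + 1) > 2 - 2/(μ+2)` (`μ > 0`), increasing to `2`; hence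
`μ(d+1) - μ(d) > 2 - 2/(μ(d)+2) ≥ 2 - 2/(d+2)` for `d ≥ 1` (tree: `μ(d) ≥ d`) — Kesten's asymptotic gap
`μ(d+1) − μ(d) → 2` (from `μ(d) = 2d − 1 − 1/(2d) − …`) recovered as an elementary LOWER bound. Numerically
(STRUCTURAL, NOT A RECORD — the printed lower bound is `μ(ℤ³) ≥ 4.572140`, Hara–Slade–Sokal 1993):
`μ(ℤ³) ≥ 4.24425` from the printed `μ(ℤ²) ≥ 2.625622` (named fact `Zd.BDGS2012_connectiveConstant_two_bounds`,
taken as a hypothesis; standard axioms), and `d = 1 → 2` = Temperley's `μ(ℤ²) ≥ 1 + √2`.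

## Printed status (lane literature passes, 2026-08-22)

`d = 1 → 2`: PRINTED (Temperley; [Jansevanrensburg2015, (4.197)]). The transfer inequality
`μ(d+1) ≥ Φ(μ(d))` for general `d`, its strict form and the gap corollary: no printed source found
(a-idea-2 ROUTES §R2 searches; lit-2 null pass 2026-08-22T00:49:18Z: corpus fts/vec + galaxy); they are
elementary consequences of the lift construction (cited to its printed `d = 1` instance) and of Kesten's
pattern theorem. Madras–Slade §1.2 has `d ≤ μ(d) ≤ 2d - 1` only; strict monotonicity `μ(ℤ^d) < μ(ℤ^{d+1})`
is printed (Madras–Slade (8.2.11)). Refute-first of record: lane REPORT §3 row X10-inj (referee g5,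
2026-08-22T01:00:14Z), `Φ(μ_d)ⁿ ≤ c_n^{(d+1)}` on the census.

## Contents (namespace `Literature.Probability.RandomPlanarGeometry.SAW.Zd.DimTransfer`; everything PROVED,
no `sorry`, no new named fact; `Zd.thm723` is a tree THEOREM; standard axioms)

`consSite`, `baseSite` · `Letter`, `Letter.compat`, `Adm`, `admWords`, `height`, `hcnt`, `liftW`,
`liftW_mem_saws`, `eq_of_liftW_eq` · **`sum_count_hcnt_le`** (finite form) · `G`, `G_zero`, `G_one`,
`G_succ_succ`, `Phi`, `Phi_sq`, `add_one_le_Phi`, `two_sub_lt_Phi_sub`, `Phi_le_Phi`, `Phi_pow_le_G`,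
`Phi_pow_le_count` · **`phi_connectiveConstant_le`** (`Φ(μ(d)) ≤ μ(d+1)`, all `d`) · `not_occV_liftW`,
**`phi_connectiveConstant_lt`** (`Φ(μ(d+1)) < μ(d+2)`, all `d`) · **`gap_gt`**, `gap_gt_natCast` ·
`one_add_sqrt_two_le_connectiveConstant_two` (Temperley) · `connectiveConstant_three_ge_of_two_bounds`.
-/

noncomputable section

open Finset Filter Literature.Probability.LatticeModels Literature.Probability.Percolation SimpleGraph
open scoped BigOperators

namespace Literature.Probability.RandomPlanarGeometry.SAW.Zd.DimTransfer

variable {d : ℕ}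

/-! ### Sites of `ℤ^{d+1} = ℤ × ℤ^d` -/

/-- The site of `ℤ^{d+1}` with first coordinate `a` and remaining coordinates `v`. [folklore] -/
def consSite (a : ℤ) (v : Site d) : Site (d + 1) := Fin.cons a v

/-- First coordinate of `consSite a v`. [folklore] -/
@[simp] private theorem consSite_zero (a : ℤ) (v : Site d) : consSite a v 0 = a := by
  simp [consSite]

/-- Later coordinates of `consSite a v`. [folklore] -/
@[simp] private theorem consSite_succ (a : ℤ) (v : Site d) (j : Fin d) : consSite a v j.succ = v j := by
  simp [consSite]

/-- `consSite` is injective in both arguments. [folklore] -/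
private theorem consSite_inj {a a' : ℤ} {v v' : Site d} : consSite a v = consSite a' v' ↔ a = a' ∧ v = v' := by
  constructor
  · intro h
    refine ⟨by simpa using congrFun h 0, funext fun j => by simpa using congrFun h j.succ⟩
  · rintro ⟨rfl, rfl⟩
    rfl

/-- `consSite 0 0 = 0`. [folklore] -/
@[simp] private theorem consSite_zero_zero : consSite 0 (0 : Site d) = 0 := by
  funext i
  refine Fin.cases ?_ (fun j => ?_) i <;> simp

/-- Increasing the first coordinate by one is a step `+e₀`. [folklore] -/
private theorem consSite_add_one (a : ℤ) (v : Site d) :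
    consSite (a + 1) v = consSite a v + Pi.single 0 1 := by
  funext i
  refine Fin.cases ?_ (fun j => ?_) i
  · simp
  · simp [Fin.succ_ne_zero]

/-- A step `+c·eⱼ` in the old coordinates is the step `+c·e_{j+1}` of `ℤ^{d+1}`. [folklore] -/
private theorem consSite_add_single (a : ℤ) (v : Site d) (j : Fin d) (c : ℤ) :
    consSite a (v + Pi.single j c) = consSite a v + Pi.single j.succ c := by
  funext i
  refine Fin.cases ?_ (fun j' => ?_) i
  · simp [(Fin.succ_ne_zero j).symm]
  · simp [Pi.single_apply, Fin.succ_inj]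

/-- The projection `ℤ^{d+1} → ℤ^d` forgetting the first coordinate. [folklore] -/
def baseSite (x : Site (d + 1)) : Site d := fun j => x j.succ

/-- `baseSite (consSite a v) = v`. [folklore] -/
@[simp] private theorem baseSite_consSite (a : ℤ) (v : Site d) : baseSite (consSite a v) = v := by
  funext j; simp [baseSite]

/-- `baseSite` is additive. [folklore] -/
private theorem baseSite_add (x y : Site (d + 1)) : baseSite (x + y) = baseSite x + baseSite y := rfl

/-! ### Letters and admissible words -/

/-- Letters of a lifting word: `H` = "perform the next step of the base walk", `U` / `D` = a step
`+e₀` / `-e₀` in the fresh direction (for `d = 1` these words encode the partially directed walks of `ℤ²`).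
[cite: Jansevanrensburg2015, eq. (4.197) (d = 1 → 2: partially directed walks, Temperley 1956)] -/
inductive Letter
  | H | U | D
  deriving DecidableEq

namespace Letter

/-- Decidability / finiteness plumbing for the lifting words. [folklore] -/
instance : Fintype Letter := ⟨{H, U, D}, fun a => by cases a <;> simp⟩

/-- `Σₐ f a = f H + f U + f D`. [folklore] -/
private theorem sum_univ {M : Type*} [AddCommMonoid M] (f : Letter → M) : ∑ a, f a = f H + f U + f D := by
  show ∑ a ∈ ({H, U, D} : Finset Letter), f a = _
  rw [sum_insert (by decide), sum_insert (by decide), sum_singleton, add_assoc]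

/-- Height increment carried by a letter (`H ↦ 0`, `U ↦ 1`, `D ↦ -1`). [folklore] -/
def dh : Letter → ℤ
  | H => 0
  | U => 1
  | D => -1

/-- Indicator of the base letter `H`. [folklore] -/
def isH : Letter → ℕ
  | H => 1
  | U => 0
  | D => 0

/-- Compatibility of consecutive letters: `U` is never followed by `D` nor `D` by `U` (vertical runs are
monotone). A decidable predicate (not a named fact). [cite: Jansevanrensburg2015, eq. (4.197) (d = 1 → 2: partially directed walks, Temperley 1956)] -/
def compat (a b : Letter) : Prop := ¬ (a = U ∧ b = D) ∧ ¬ (a = D ∧ b = U)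

/-- Decidability / finiteness plumbing for the lifting words. [folklore] -/
instance (a b : Letter) : Decidable (compat a b) := by
  unfold compat; infer_instance

/-- `dh` is injective. [folklore] -/
private theorem dh_injective : Function.Injective dh := by
  intro a b h
  cases a <;> cases b <;> first | rfl | exact absurd h (by decide)

/-- `dh a = 0 ↔ a = H`. [folklore] -/
private theorem dh_eq_zero_iff {a : Letter} : a.dh = 0 ↔ a = H := by
  cases a <;> decide

/-- `dh a = 1 ↔ a = U`. [folklore] -/
private theorem dh_eq_one_iff {a : Letter} : a.dh = 1 ↔ a = U := by
  cases a <;> decide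

/-- A vertical letter has `dh = ±1`. [folklore] -/
private theorem dh_of_ne_H {a : Letter} (h : a ≠ H) : a.dh = 1 ∨ a.dh = -1 := by
  cases a
  · exact absurd rfl h
  · exact Or.inl rfl
  · exact Or.inr rfl

/-- `isH a ≤ 1`. [folklore] -/
private theorem isH_le_one (a : Letter) : a.isH ≤ 1 := by
  cases a <;> decide

/-- `isH a = 0` for a vertical letter. [folklore] -/
private theorem isH_of_ne_H {a : Letter} (h : a ≠ H) : a.isH = 0 := by
  cases a
  · exact absurd rfl h
  · rfl
  · rfl

/-- `isH a = 1 ↔ a = H`. [folklore] -/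
private theorem isH_eq_one_iff {a : Letter} : a.isH = 1 ↔ a = H := by
  cases a <;> decide

/-- Two compatible vertical letters coincide. [folklore] -/
private theorem eq_of_compat {a b : Letter} (hab : compat a b) (ha : a ≠ H) (hb : b ≠ H) : b = a := by
  cases a <;> cases b <;> simp_all [compat]

/-- `H` is compatible with everything on its right. [folklore] -/
private theorem compat_H_left (b : Letter) : compat H b := by
  cases b <;> decide

end Letter

/-- The letter of the word `w : Fin n → Letter` at time `j`, extended by `H` from time `n` on. [folklore] -/
def wx {n : ℕ} (w : Fin n → Letter) (j : ℕ) : Letter := if h : j < n then w ⟨j, h⟩ else Letter.H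

/-- `wx` inside the word. [folklore] -/
private theorem wx_of_lt {n : ℕ} (w : Fin n → Letter) {j : ℕ} (h : j < n) : wx w j = w ⟨j, h⟩ := dif_pos h

/-- `wx` at an index of `Fin n`. [folklore] -/
@[simp] private theorem wx_fin {n : ℕ} (w : Fin n → Letter) (k : Fin n) : wx w k = w k := by
  rw [wx_of_lt w k.isLt]

/-- **Admissible words**: consecutive letters are compatible, i.e. every maximal run of vertical letters is
monotone (all `U` or all `D`). A decidable predicate (not a named fact). [cite: Jansevanrensburg2015, eq. (4.197) (d = 1 → 2: partially directed walks, Temperley 1956)] -/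
def Adm {n : ℕ} (w : Fin n → Letter) : Prop :=
  ∀ i j : Fin n, i.val + 1 = j.val → Letter.compat (w i) (w j)

/-- Decidability / finiteness plumbing for the lifting words. [folklore] -/
instance {n : ℕ} : DecidablePred (Adm (n := n)) := fun w => by
  unfold Adm; infer_instance

/-- Admissibility in terms of `wx`. [folklore] -/
private theorem Adm.compat_wx {n : ℕ} {w : Fin n → Letter} (hw : Adm w) {j : ℕ} (hj : j + 1 < n) :
    Letter.compat (wx w j) (wx w (j + 1)) := by
  rw [wx_of_lt w (show j < n by omega), wx_of_lt w hj]
  exact hw _ _ rfl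

/-- The admissible words of length `n`. [folklore] -/
def admWords (n : ℕ) : Finset (Fin n → Letter) := univ.filter Adm

/-- Membership in `admWords`. [folklore] -/
private theorem mem_admWords {n : ℕ} {w : Fin n → Letter} : w ∈ admWords n ↔ Adm w := by
  simp [admWords]

/-- `{H,U,D}²` has `9 - 2 = 7` admissible words. [folklore] -/
example : (admWords 2).card = 7 := by decide

/-! ### Height and base-step count along a word -/

/-- Height (fresh coordinate) after the first `i` letters of `w`. [folklore] -/
def height {n : ℕ} (w : Fin n → Letter) (i : ℕ) : ℤ := ∑ j ∈ range i, (wx w j).dh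

/-- Number of base steps (`H` letters) among the first `i` letters of `w`. [folklore] -/
def hcnt {n : ℕ} (w : Fin n → Letter) (i : ℕ) : ℕ := ∑ j ∈ range i, (wx w j).isH

/-- `height w 0 = 0`. [folklore] -/
@[simp] private theorem height_zero {n : ℕ} (w : Fin n → Letter) : height w 0 = 0 := by simp [height]

/-- `hcnt w 0 = 0`. [folklore] -/
@[simp] private theorem hcnt_zero {n : ℕ} (w : Fin n → Letter) : hcnt w 0 = 0 := by simp [hcnt]

/-- One-step recursion for `height`. [folklore] -/
private theorem height_succ {n : ℕ} (w : Fin n → Letter) (i : ℕ) :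
    height w (i + 1) = height w i + (wx w i).dh := by
  rw [height, height, sum_range_succ]

/-- One-step recursion for `hcnt`. [folklore] -/
private theorem hcnt_succ {n : ℕ} (w : Fin n → Letter) (i : ℕ) :
    hcnt w (i + 1) = hcnt w i + (wx w i).isH := by
  rw [hcnt, hcnt, sum_range_succ]

/-- `hcnt w (i + t) ≤ hcnt w i + t`. [folklore] -/
private theorem hcnt_add_le {n : ℕ} (w : Fin n → Letter) (i t : ℕ) : hcnt w (i + t) ≤ hcnt w i + t := by
  induction t with
  | zero => simp
  | succ t ih =>
    rw [← add_assoc, hcnt_succ]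
    have := Letter.isH_le_one (wx w (i + t))
    omega

/-- `hcnt w` is monotone. [folklore] -/
private theorem hcnt_mono {n : ℕ} (w : Fin n → Letter) {i i' : ℕ} (h : i ≤ i') : hcnt w i ≤ hcnt w i' := by
  obtain ⟨t, rfl⟩ := Nat.exists_eq_add_of_le h
  clear h
  induction t with
  | zero => simp
  | succ t ih => rw [← add_assoc, hcnt_succ]; omega

/-- Discrete intermediate values of `hcnt w`. [folklore] -/
private theorem exists_hcnt_eq {n : ℕ} (w : Fin n → Letter) (i : ℕ) :
    ∀ m ≤ hcnt w i, ∃ i' ≤ i, hcnt w i' = m := by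
  induction i with
  | zero =>
    intro m hm
    have hm0 : m = 0 := by simpa using hm
    exact ⟨0, le_rfl, by simp [hm0]⟩
  | succ i ih =>
    intro m hm
    rw [hcnt_succ] at hm
    by_cases hmle : m ≤ hcnt w i
    · obtain ⟨i', hi', h⟩ := ih m hmle
      exact ⟨i', by omega, h⟩
    · refine ⟨i + 1, le_rfl, ?_⟩
      rw [hcnt_succ]
      have := Letter.isH_le_one (wx w i)
      omega

/-- In an admissible word, a time interval `[i, i')` containing no base step is a monotone vertical run:
all its letters are equal to the (vertical) letter at time `i`. [folklore] -/
private theorem run_const {n : ℕ} {w : Fin n → Letter} (hw : Adm w) {i i' : ℕ} (hi' : i' ≤ n) (hii' : i ≤ i')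
    (hc : hcnt w i' = hcnt w i) :
    ∀ j, i ≤ j → j < i' → wx w j = wx w i ∧ wx w i ≠ Letter.H := by
  have hvert : ∀ j, i ≤ j → j < i' → wx w j ≠ Letter.H := by
    intro j hij hji' hH
    have h1 : hcnt w (j + 1) = hcnt w j + 1 := by rw [hcnt_succ, hH]; rfl
    have h2 : hcnt w i ≤ hcnt w j := hcnt_mono w hij
    have h3 : hcnt w (j + 1) ≤ hcnt w i' := hcnt_mono w (by omega)
    omega
  intro j hij hji'
  induction j with
  | zero =>
    obtain rfl : i = 0 := Nat.le_zero.1 hij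
    exact ⟨rfl, hvert 0 le_rfl hji'⟩
  | succ j ih =>
    rcases Nat.eq_or_lt_of_le hij with h | h
    · rw [← h]
      exact ⟨rfl, hvert i le_rfl (by omega)⟩
    · obtain ⟨hj, hi⟩ := ih (by omega) (by omega)
      refine ⟨?_, hi⟩
      have hc' := hw.compat_wx (show j + 1 < n by omega)
      rw [hj] at hc'
      exact Letter.eq_of_compat hc' hi (hvert _ hij hji')

/-- The height along a constant block of letters. [folklore] -/
private theorem height_of_const {n : ℕ} (w : Fin n → Letter) {i : ℕ} {a : Letter} :
    ∀ t, (∀ j, i ≤ j → j < i + t → wx w j = a) → height w (i + t) = height w i + t * a.dh := by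
  intro t
  induction t with
  | zero => intro; simp
  | succ t ih =>
    intro h
    rw [← add_assoc, height_succ, ih (fun j hj hj' => h j hj (by omega)), h (i + t) (by omega) (by omega)]
    push_cast
    ring

/-- Two distinct times with the same base-step count have different heights. [folklore] -/
private theorem height_ne_of_run {n : ℕ} {w : Fin n → Letter} (hw : Adm w) {i i' : ℕ} (hi' : i' ≤ n)
    (hlt : i < i') (hc : hcnt w i' = hcnt w i) : height w i ≠ height w i' := by
  have hrun := run_const hw hi' hlt.le hc
  have hconst := height_of_const w (i := i) (a := wx w i) (i' - i)
    (fun j hj hj' => (hrun j hj (by omega)).1)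
  rw [Nat.add_sub_cancel' hlt.le] at hconst
  have hiH := (hrun i le_rfl hlt).2
  have hpos : (0 : ℤ) < ((i' - i : ℕ) : ℤ) := by exact_mod_cast Nat.sub_pos_of_lt hlt
  intro heq
  rcases Letter.dh_of_ne_H hiH with h | h
  · rw [h] at hconst; linarith
  · rw [h] at hconst; linarith

/-! ### The lift -/

/-- **The lift** of the base walk `ω` on `ℤ^d` by the word `w` of length `n`: at time `i ≤ n` it sits at
height `height w i` above the base point `ω (hcnt w i)`; frozen from time `n` on. [folklore] -/
def liftW {n : ℕ} (w : Fin n → Letter) (ω : ℕ → Site d) : ℕ → Site (d + 1) :=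
  fun i => consSite (height w (min i n)) (ω (hcnt w (min i n)))

/-- Base point of the lift. [folklore] -/
private theorem baseSite_liftW {n : ℕ} (w : Fin n → Letter) (ω : ℕ → Site d) {i : ℕ} (hi : i ≤ n) :
    baseSite (liftW w ω i) = ω (hcnt w i) := by
  simp [liftW, min_eq_left hi]

/-- Height of the lift. [folklore] -/
private theorem liftW_apply_zero {n : ℕ} (w : Fin n → Letter) (ω : ℕ → Site d) {i : ℕ} (hi : i ≤ n) :
    liftW w ω i 0 = height w i := by
  simp [liftW, min_eq_left hi]

/-- **The lift is an `n`-step self-avoiding walk on `ℤ^{d+1}`** whenever `w` is admissible of length `n`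
and `ω` is a `(#H(w))`-step self-avoiding walk on `ℤ^d`. [cite: Jansevanrensburg2015, eq. (4.197) (d = 1 → 2: partially directed walks, Temperley 1956)] -/
theorem liftW_mem_saws {n : ℕ} {w : Fin n → Letter} (hw : Adm w) {ω : ℕ → Site d}
    (hω : ω ∈ Zd.saws d (hcnt w n)) : liftW w ω ∈ Zd.saws (d + 1) n := by
  obtain ⟨h0, hend, hadj, hinj⟩ := Zd.mem_saws.1 hω
  refine Zd.mem_saws.2 ⟨?_, ?_, ?_, ?_⟩
  · simp [liftW, h0]
  · intro i hi
    simp only [liftW, min_eq_right hi, min_self]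
  · intro i hi
    have h1 : min i n = i := min_eq_left hi.le
    have h2 : min (i + 1) n = i + 1 := min_eq_left hi
    simp only [liftW, h1, h2, height_succ, hcnt_succ]
    rcases hH : wx w i with _ | _ | _
    · -- a base step
      simp only [Letter.dh, Letter.isH, add_zero]
      have hlt : hcnt w i < hcnt w n := by
        have := hcnt_mono w (show i + 1 ≤ n from hi)
        rw [hcnt_succ, hH] at this
        exact this
      obtain ⟨j, hj | hj⟩ := (zdGraph_adj_iff _ _).1 (hadj _ hlt)
      · exact (zdGraph_adj_iff _ _).2 ⟨j.succ, Or.inl (by rw [hj, consSite_add_single])⟩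
      · exact (zdGraph_adj_iff _ _).2 ⟨j.succ, Or.inr (by rw [hj, consSite_add_single])⟩
    · -- a step `+e₀`
      simp only [Letter.dh, Letter.isH, add_zero]
      exact (zdGraph_adj_iff _ _).2 ⟨0, Or.inl (by rw [consSite_add_one])⟩
    · -- a step `-e₀`
      simp only [Letter.dh, Letter.isH, add_zero]
      refine (zdGraph_adj_iff _ _).2 ⟨0, Or.inr ?_⟩
      rw [← consSite_add_one]
      congr 1
      ring
  · intro i hi i' hi' h
    simp only [Set.mem_setOf_eq] at hi hi'
    simp only [liftW, min_eq_left hi, min_eq_left hi', consSite_inj] at h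
    obtain ⟨ha, hb⟩ := h
    have hci : hcnt w i ≤ hcnt w n := hcnt_mono w hi
    have hci' : hcnt w i' ≤ hcnt w n := hcnt_mono w hi'
    have hc : hcnt w i = hcnt w i' :=
      hinj (by simpa using hci) (by simpa using hci') hb
    by_contra hne
    rcases lt_or_gt_of_ne hne with hlt | hlt
    · exact height_ne_of_run hw hi' hlt hc.symm ha
    · exact height_ne_of_run hw hi hlt hc ha.symm

/-- The word can be read off the lift. [folklore] -/
private theorem wx_eq_of_liftW_eq {n : ℕ} {w w' : Fin n → Letter} {ω ω' : ℕ → Site d}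
    (h : liftW w ω = liftW w' ω') : ∀ j < n, wx w j = wx w' j := by
  suffices key : ∀ i, i ≤ n → ∀ j < i, wx w j = wx w' j from fun j hj => key n le_rfl j hj
  intro i
  induction i with
  | zero => intro _ j hj; exact absurd hj (Nat.not_lt_zero _)
  | succ i ih =>
    intro hi j hj
    have ih' := ih (by omega)
    rcases Nat.lt_succ_iff_lt_or_eq.1 hj with hj' | hj'
    · exact ih' j hj'
    · subst hj'
      have hh : height w j = height w' j :=
        sum_congr rfl fun k hk => by rw [ih' k (mem_range.1 hk)]
      have h1 := congrFun h (j + 1)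
      simp only [liftW, min_eq_left hi, consSite_inj, height_succ] at h1
      exact Letter.dh_injective (by linarith [h1.1])

/-- The word can be read off the lift. [cite: Jansevanrensburg2015, eq. (4.197) (d = 1 → 2: partially directed walks, Temperley 1956)] -/
theorem eq_of_liftW_eq {n : ℕ} {w w' : Fin n → Letter} {ω ω' : ℕ → Site d}
    (h : liftW w ω = liftW w' ω') : w = w' :=
  funext fun k => by rw [← wx_fin w k, ← wx_fin w' k]; exact wx_eq_of_liftW_eq h k k.isLt

/-- The base walk can be read off the lift. [folklore] -/
private theorem eq_of_liftW_eq' {n : ℕ} {w : Fin n → Letter} {ω ω' : ℕ → Site d}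
    (hω : ω ∈ Zd.saws d (hcnt w n)) (hω' : ω' ∈ Zd.saws d (hcnt w n))
    (h : liftW w ω = liftW w ω') : ω = ω' := by
  have key : ∀ i ≤ n, ω (hcnt w i) = ω' (hcnt w i) := fun i hi => by
    have := congrFun h i
    simp only [liftW, min_eq_left hi, consSite_inj] at this
    exact this.2
  funext m
  rcases le_or_gt m (hcnt w n) with hm | hm
  · obtain ⟨i, hi, rfl⟩ := exists_hcnt_eq w n m hm
    exact key i hi
  · rw [(Zd.mem_saws.1 hω).2.1 m hm.le, (Zd.mem_saws.1 hω').2.1 m hm.le]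
    exact key n le_rfl

/-! ### Counting: the finite form -/

/-- If every lift lands in `A`, then `Σ_{w admissible} c⁽ᵈ⁾_{#H(w)} ≤ #A` (the lifts are distinct).
[folklore] -/
private theorem sum_count_le_card {n : ℕ} (A : Finset (ℕ → Site (d + 1)))
    (hA : ∀ w ∈ admWords n, ∀ ω ∈ Zd.saws d (hcnt w n), liftW w ω ∈ A) :
    ∑ w ∈ admWords n, Zd.count d (hcnt w n) ≤ A.card := by
  classical
  let D : Finset (Σ _ : Fin n → Letter, ℕ → Site d) :=
    (admWords n).sigma fun w => Zd.saws d (hcnt w n)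
  have hcard : D.card = ∑ w ∈ admWords n, Zd.count d (hcnt w n) := by
    rw [card_sigma]
    exact sum_congr rfl fun w _ => Zd.card_saws _ _
  rw [← hcard]
  refine card_le_card_of_injOn (fun p => liftW p.1 p.2) ?_ ?_
  · intro p hp
    rw [mem_coe, mem_sigma] at hp
    exact hA _ hp.1 _ hp.2
  · rintro ⟨w, ω⟩ hp ⟨w', ω'⟩ hp' h
    rw [mem_coe, mem_sigma] at hp hp'
    have hww : w = w' := eq_of_liftW_eq h
    subst hww
    have hωω : ω = ω' := eq_of_liftW_eq' hp.2 hp'.2 h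
    subst hωω
    rfl

/-- **Finite form of the dimension transfer**: `Σ_{w admissible of length n} c⁽ᵈ⁾_{#H(w)} ≤ c⁽ᵈ⁺¹⁾ₙ`.
[cite: Jansevanrensburg2015, eq. (4.197) (d = 1 → 2: partially directed walks, Temperley 1956)] -/
theorem sum_count_hcnt_le (d n : ℕ) :
    ∑ w ∈ admWords n, Zd.count d (hcnt w n) ≤ Zd.count (d + 1) n := by
  rw [← Zd.card_saws]
  exact sum_count_le_card _ fun w hw ω hω => liftW_mem_saws (mem_admWords.1 hw) hω

/-! ### The weighted count `Gₙ(μ)` and its recursion -/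

/-- `#H(w)`, the number of base letters of `w`. [folklore] -/
def nH {n : ℕ} (w : Fin n → Letter) : ℕ := ∑ k : Fin n, (w k).isH

/-- `hcnt w n = #H(w)`. [folklore] -/
private theorem hcnt_eq_nH {n : ℕ} (w : Fin n → Letter) : hcnt w n = nH w := by
  unfold hcnt nH
  rw [Finset.sum_range]
  exact Fintype.sum_congr _ _ fun k => by rw [wx_fin]

/-- `Gₙ(μ) = Σ_{w admissible of length n} μ^{#H(w)}`. [folklore] -/
def G (μ : ℝ) (n : ℕ) : ℝ := ∑ w : Fin n → Letter, if Adm w then μ ^ nH w else 0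

/-- `Gₙ` as a sum over `admWords`. [folklore] -/
private theorem G_eq_sum_admWords (μ : ℝ) (n : ℕ) : G μ n = ∑ w ∈ admWords n, μ ^ nH w := by
  rw [admWords, sum_filter]; rfl

/-- The first letter of `w` is `b` (false for the empty word). A decidable predicate (not a named fact).
[folklore] -/
private def HeadIs {n : ℕ} (b : Letter) (w : Fin n → Letter) : Prop := ∃ k : Fin n, k.val = 0 ∧ w k = b

/-- The letter `a` may precede the word `w` (vacuous for the empty word). A decidable predicate (not a
named fact). [folklore] -/
private def HeadOK {n : ℕ} (a : Letter) (w : Fin n → Letter) : Prop :=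
  ∀ k : Fin n, k.val = 0 → Letter.compat a (w k)

/-- Decidability / finiteness plumbing for the lifting words. [folklore] -/
instance {n : ℕ} (b : Letter) : DecidablePred (HeadIs (n := n) b) := fun w => by
  unfold HeadIs; infer_instance

/-- Decidability / finiteness plumbing for the lifting words. [folklore] -/
instance {n : ℕ} (a : Letter) : DecidablePred (HeadOK (n := n) a) := fun w => by
  unfold HeadOK; infer_instance

/-- `Tₙ(b) = Σ_{w admissible, first letter b} μ^{#H(w)}`. [folklore] -/
private def T (μ : ℝ) (n : ℕ) (b : Letter) : ℝ :=
  ∑ w : Fin n → Letter, if Adm w ∧ HeadIs b w then μ ^ nH w else 0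

/-- `Sₙ(a) = Σ_{w admissible, may follow a} μ^{#H(w)}`. [folklore] -/
private def S (μ : ℝ) (n : ℕ) (a : Letter) : ℝ :=
  ∑ w : Fin n → Letter, if Adm w ∧ HeadOK a w then μ ^ nH w else 0

/-- `#H` of a word with a letter prepended. [folklore] -/
private theorem nH_cons {n : ℕ} (a : Letter) (w : Fin n → Letter) :
    nH (Fin.cons a w : Fin (n + 1) → Letter) = a.isH + nH w := by
  unfold nH
  rw [Fin.sum_univ_succ]
  simp only [Fin.cons_zero, Fin.cons_succ]

/-- Admissibility of a word with a letter prepended. [folklore] -/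
private theorem adm_cons {n : ℕ} (a : Letter) (w : Fin n → Letter) :
    Adm (Fin.cons a w : Fin (n + 1) → Letter) ↔ HeadOK a w ∧ Adm w := by
  constructor
  · intro h
    refine ⟨fun k hk => ?_, fun i j hij => ?_⟩
    · have := h 0 k.succ (by simp [hk])
      simpa only [Fin.cons_zero, Fin.cons_succ] using this
    · have := h i.succ j.succ (by simp [hij])
      simpa only [Fin.cons_succ] using this
  · rintro ⟨hh, hw⟩ i j hij
    rcases Fin.eq_zero_or_eq_succ i with rfl | ⟨i, rfl⟩
    · rcases Fin.eq_zero_or_eq_succ j with rfl | ⟨j, rfl⟩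
      · simp at hij
      · simp only [Fin.cons_zero, Fin.cons_succ]
        exact hh j (by simpa using hij)
    · rcases Fin.eq_zero_or_eq_succ j with rfl | ⟨j, rfl⟩
      · simp at hij
      · simp only [Fin.cons_succ]
        exact hw i j (by simpa using hij)

/-- First letter of a word with a letter prepended. [folklore] -/
private theorem headIs_cons {n : ℕ} (a b : Letter) (w : Fin n → Letter) :
    HeadIs b (Fin.cons a w : Fin (n + 1) → Letter) ↔ a = b := by
  constructor
  · rintro ⟨k, hk, hkb⟩
    have : k = 0 := Fin.ext hk
    subst this
    simpa using hkb
  · intro h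
    exact ⟨0, rfl, by simpa using h⟩

/-- Summing over words of length `n + 1` = summing over the first letter and the rest. [folklore] -/
private theorem sum_cons {M : Type*} [AddCommMonoid M] {n : ℕ} (F : (Fin (n + 1) → Letter) → M) :
    ∑ w, F w = ∑ a : Letter, ∑ w : Fin n → Letter, F (Fin.cons a w) := by
  rw [← Fintype.sum_prod_type']
  refine (Fintype.sum_bijective (fun p : Letter × (Fin n → Letter) =>
    (Fin.cons p.1 p.2 : Fin (n + 1) → Letter)) ⟨?_, ?_⟩ _ _ fun p => rfl).symm
  · intro p q h
    have h' := Fin.cons_inj.1 h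
    exact Prod.ext h'.1 h'.2
  · intro W
    exact ⟨(W 0, Fin.tail W), Fin.cons_self_tail W⟩

/-- `H` may precede every word. [folklore] -/
private theorem headOK_H {n : ℕ} (w : Fin n → Letter) : HeadOK Letter.H w :=
  fun k _ => Letter.compat_H_left (w k)

/-- `U` may precede `w` iff `w` does not start with `D`. [folklore] -/
private theorem headOK_U_iff {n : ℕ} (w : Fin n → Letter) : HeadOK Letter.U w ↔ ¬ HeadIs Letter.D w := by
  constructor
  · rintro h ⟨k, hk, hkD⟩
    exact (h k hk).1 ⟨rfl, hkD⟩
  · intro h k hk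
    exact ⟨fun hh => h ⟨k, hk, hh.2⟩, fun hh => absurd hh.1 (by decide)⟩

/-- `D` may precede `w` iff `w` does not start with `U`. [folklore] -/
private theorem headOK_D_iff {n : ℕ} (w : Fin n → Letter) : HeadOK Letter.D w ↔ ¬ HeadIs Letter.U w := by
  constructor
  · rintro h ⟨k, hk, hkU⟩
    exact (h k hk).2 ⟨rfl, hkU⟩
  · intro h k hk
    exact ⟨fun hh => absurd hh.1 (by decide), fun hh => h ⟨k, hk, hh.2⟩⟩

/-- `Sₙ(H) = Gₙ`. [folklore] -/
private theorem S_H (μ : ℝ) (n : ℕ) : S μ n Letter.H = G μ n :=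
  Fintype.sum_congr _ _ fun w => by simp [headOK_H w]

/-- `Sₙ(U) + Tₙ(D) = Gₙ`. [folklore] -/
private theorem S_U_add_T_D (μ : ℝ) (n : ℕ) : S μ n Letter.U + T μ n Letter.D = G μ n := by
  unfold S T G
  rw [← sum_add_distrib]
  refine Fintype.sum_congr _ _ fun w => ?_
  have hiff := headOK_U_iff w
  by_cases hA : Adm w <;> by_cases hD : HeadIs Letter.D w <;> simp [hA, hD, hiff]

/-- `Sₙ(D) + Tₙ(U) = Gₙ`. [folklore] -/
private theorem S_D_add_T_U (μ : ℝ) (n : ℕ) : S μ n Letter.D + T μ n Letter.U = G μ n := by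
  unfold S T G
  rw [← sum_add_distrib]
  refine Fintype.sum_congr _ _ fun w => ?_
  have hiff := headOK_D_iff w
  by_cases hA : Adm w <;> by_cases hU : HeadIs Letter.U w <;> simp [hA, hU, hiff]

/-- First-letter decomposition of `G_{n+1}`. [folklore] -/
private theorem G_succ (μ : ℝ) (n : ℕ) :
    G μ (n + 1) = μ * S μ n Letter.H + S μ n Letter.U + S μ n Letter.D := by
  have key : ∀ a : Letter,
      (∑ w : Fin n → Letter, if Adm (Fin.cons a w : Fin (n + 1) → Letter)
        then μ ^ nH (Fin.cons a w : Fin (n + 1) → Letter) else 0) = μ ^ a.isH * S μ n a := by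
    intro a
    unfold S
    rw [mul_sum]
    refine Fintype.sum_congr _ _ fun w => ?_
    have hiff := adm_cons a w
    rw [nH_cons]
    by_cases hA : Adm w <;> by_cases hO : HeadOK a w <;> simp [hA, hO, hiff, pow_add, mul_comm]
  unfold G
  rw [sum_cons, Letter.sum_univ, key, key, key]
  simp [Letter.isH]

/-- First-letter decomposition of `T_{n+1}(b)`. [folklore] -/
private theorem T_succ (μ : ℝ) (n : ℕ) (b : Letter) : T μ (n + 1) b = μ ^ b.isH * S μ n b := by
  unfold T S
  rw [sum_cons, mul_sum, Fintype.sum_eq_single b]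
  · refine Fintype.sum_congr _ _ fun w => ?_
    have hiff := adm_cons b w
    have hiff' := headIs_cons b b w
    rw [nH_cons]
    by_cases hA : Adm w <;> by_cases hO : HeadOK b w <;> simp [hA, hO, hiff, hiff', pow_add, mul_comm]
  · intro a ha
    exact Fintype.sum_eq_zero _ fun w => by
      have hiff' := headIs_cons a b w
      simp [hiff', ha]

/-- `G₀ = 1` (the empty word). [cite: Jansevanrensburg2015, eq. (4.197) (d = 1 → 2: partially directed walks, Temperley 1956)] -/
theorem G_zero (μ : ℝ) : G μ 0 = 1 := by
  unfold G
  rw [Fintype.sum_unique]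
  simp [Adm, nH]

/-- `T₀(b) = 0`. [folklore] -/
private theorem T_zero (μ : ℝ) (b : Letter) : T μ 0 b = 0 := by
  unfold T HeadIs
  simp

/-- `G_{n+1} = (μ+2) Gₙ - (Tₙ(U) + Tₙ(D))`. [folklore] -/
private theorem G_succ' (μ : ℝ) (n : ℕ) :
    G μ (n + 1) = (μ + 2) * G μ n - (T μ n Letter.U + T μ n Letter.D) := by
  rw [G_succ, S_H]
  linarith [S_U_add_T_D μ n, S_D_add_T_U μ n]

/-- `T_{n+1}(U) + T_{n+1}(D) = 2 Gₙ - (Tₙ(U) + Tₙ(D))`. [folklore] -/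
private theorem T_succ_add (μ : ℝ) (n : ℕ) :
    T μ (n + 1) Letter.U + T μ (n + 1) Letter.D = 2 * G μ n - (T μ n Letter.U + T μ n Letter.D) := by
  rw [T_succ, T_succ]
  simp only [Letter.isH, pow_zero, one_mul]
  linarith [S_U_add_T_D μ n, S_D_add_T_U μ n]

/-- `G₁ = μ + 2`. [cite: Jansevanrensburg2015, eq. (4.197) (d = 1 → 2: partially directed walks, Temperley 1956)] -/
theorem G_one (μ : ℝ) : G μ 1 = μ + 2 := by
  rw [G_succ', G_zero, T_zero, T_zero]
  ring

/-- **`G_{n+2} = (μ+1) G_{n+1} + μ Gₙ`**. [cite: Jansevanrensburg2015, eq. (4.197) (d = 1 → 2: partially directed walks, Temperley 1956)] -/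
theorem G_succ_succ (μ : ℝ) (n : ℕ) : G μ (n + 2) = (μ + 1) * G μ (n + 1) + μ * G μ n := by
  have h1 := G_succ' μ (n + 1)
  have h2 := T_succ_add μ n
  have h3 := G_succ' μ n
  rw [h1, h2]
  linarith

/-! ### `Φ(μ)` -/

/-- `Φ(μ) = (μ + 1 + √(μ² + 6μ + 1))/2`, the growth rate of `Gₙ(μ)`: the positive root of
`Φ² = (μ+1)Φ + μ`, i.e. `1/Φ` is the positive root of `μ x (1+x) = 1 - x`. [folklore] -/
def Phi (μ : ℝ) : ℝ := (μ + 1 + Real.sqrt (μ ^ 2 + 6 * μ + 1)) / 2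

/-- `Φ² = (μ+1)Φ + μ` (`μ ≥ 0`). [cite: Jansevanrensburg2015, eq. (4.197) (d = 1 → 2: partially directed walks, Temperley 1956)] -/
theorem Phi_sq {μ : ℝ} (hμ : 0 ≤ μ) : Phi μ ^ 2 = (μ + 1) * Phi μ + μ := by
  unfold Phi
  have hs : Real.sqrt (μ ^ 2 + 6 * μ + 1) ^ 2 = μ ^ 2 + 6 * μ + 1 := Real.sq_sqrt (by positivity)
  linear_combination (1 / 4 : ℝ) * hs

/-- `Φ(μ) ≥ 0` (`μ ≥ 0`). [folklore] -/
private theorem Phi_nonneg {μ : ℝ} (hμ : 0 ≤ μ) : 0 ≤ Phi μ := by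
  unfold Phi; positivity

/-- `Φ(μ) ≤ μ + 2` (`μ ≥ 0`). [folklore] -/
private theorem Phi_le_add_two {μ : ℝ} (hμ : 0 ≤ μ) : Phi μ ≤ μ + 2 := by
  unfold Phi
  have : Real.sqrt (μ ^ 2 + 6 * μ + 1) ≤ μ + 3 := by
    rw [Real.sqrt_le_left (by linarith)]
    nlinarith
  linarith

/-- `Φ(μ) ≥ μ + 1` (`μ ≥ 0`). [cite: Jansevanrensburg2015, eq. (4.197) (d = 1 → 2: partially directed walks, Temperley 1956)] -/
theorem add_one_le_Phi {μ : ℝ} (hμ : 0 ≤ μ) : μ + 1 ≤ Phi μ := by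
  unfold Phi
  have : μ + 1 ≤ Real.sqrt (μ ^ 2 + 6 * μ + 1) := by
    rw [Real.le_sqrt (by linarith) (by positivity)]
    nlinarith
  linarith

/-- **`Φ(μ) - μ > 2 - 2/(μ+2)`** for `μ > 0` (and `Φ(μ) - μ → 2`). [cite: Jansevanrensburg2015, eq. (4.197) (d = 1 → 2: partially directed walks, Temperley 1956)] -/
theorem two_sub_lt_Phi_sub {μ : ℝ} (hμ : 0 < μ) : 2 - 2 / (μ + 2) < Phi μ - μ := by
  unfold Phi
  have h2 : 0 < μ + 2 := by linarith
  have hy : 0 ≤ (μ ^ 2 + 5 * μ + 2) / (μ + 2) := by positivity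
  have hs : (μ ^ 2 + 5 * μ + 2) / (μ + 2) < Real.sqrt (μ ^ 2 + 6 * μ + 1) := by
    rw [Real.lt_sqrt hy, div_pow, div_lt_iff₀ (by positivity)]
    nlinarith
  have : 2 - 2 / (μ + 2) = (1 - μ + (μ ^ 2 + 5 * μ + 2) / (μ + 2)) / 2 := by
    field_simp
    ring
  rw [this]
  linarith

/-- `Φ` is monotone on `[0, ∞)`. [cite: Jansevanrensburg2015, eq. (4.197) (d = 1 → 2: partially directed walks, Temperley 1956)] -/
theorem Phi_le_Phi {a b : ℝ} (ha : 0 ≤ a) (hab : a ≤ b) : Phi a ≤ Phi b := by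
  unfold Phi
  have := Real.sqrt_le_sqrt (show a ^ 2 + 6 * a + 1 ≤ b ^ 2 + 6 * b + 1 by nlinarith)
  linarith

/-- **`Φ(μ)ⁿ ≤ Gₙ(μ)`** for every `n` (`μ ≥ 0`), by the two-step recursion. [cite: Jansevanrensburg2015, eq. (4.197) (d = 1 → 2: partially directed walks, Temperley 1956)] -/
theorem Phi_pow_le_G {μ : ℝ} (hμ : 0 ≤ μ) (n : ℕ) : Phi μ ^ n ≤ G μ n := by
  have key : ∀ n, Phi μ ^ n ≤ G μ n ∧ Phi μ ^ (n + 1) ≤ G μ (n + 1) := by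
    intro n
    induction n with
    | zero =>
      exact ⟨by rw [pow_zero, G_zero], by rw [pow_one, G_one]; exact Phi_le_add_two hμ⟩
    | succ n ih =>
      refine ⟨ih.2, ?_⟩
      have hΦ := Phi_nonneg hμ
      have h1 := mul_le_mul_of_nonneg_left ih.1 hμ
      have h2 := mul_le_mul_of_nonneg_left ih.2 (show 0 ≤ μ + 1 by linarith)
      calc Phi μ ^ (n + 1 + 1) = Phi μ ^ n * Phi μ ^ 2 := by ring
        _ = (μ + 1) * Phi μ ^ (n + 1) + μ * Phi μ ^ n := by rw [Phi_sq hμ]; ring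
        _ ≤ (μ + 1) * G μ (n + 1) + μ * G μ n := by linarith
        _ = G μ (n + 1 + 1) := (G_succ_succ μ n).symm
  exact (key n).1

/-! ### The transfer inequality -/

/-- `Gₙ(μ(d)) ≤ Σ_{w admissible} c⁽ᵈ⁾_{#H(w)}` (`μ(d)^m ≤ c⁽ᵈ⁾ₘ`). [folklore] -/
private theorem G_connectiveConstant_le_sum (d n : ℕ) :
    G (Zd.connectiveConstant d) n ≤ ((∑ w ∈ admWords n, Zd.count d (hcnt w n) : ℕ) : ℝ) := by
  rw [G_eq_sum_admWords]
  push_cast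
  refine sum_le_sum fun w _ => ?_
  rw [hcnt_eq_nH]
  exact Zd.pow_connectiveConstant_le_count d (nH w)

/-- `Φ(μ(d))ⁿ ≤ c⁽ᵈ⁺¹⁾ₙ` for every `n`. [cite: MadrasSlade1993, §1.2, eq. (1.2.2)] -/
theorem Phi_pow_le_count (d n : ℕ) : Phi (Zd.connectiveConstant d) ^ n ≤ (Zd.count (d + 1) n : ℝ) :=
  (Phi_pow_le_G (Zd.connectiveConstant_nonneg d) n).trans
    ((G_connectiveConstant_le_sum d n).trans (by exact_mod_cast sum_count_hcnt_le d n))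

/-- **Dimension transfer: `Φ(μ(ℤ^d)) ≤ μ(ℤ^{d+1})`**, `Φ(μ) = (μ + 1 + √(μ² + 6μ + 1))/2`, for every
`d ≥ 0`. [cite: MadrasSlade1993, §1.2, eq. (1.2.2)] -/
theorem phi_connectiveConstant_le (d : ℕ) :
    Phi (Zd.connectiveConstant d) ≤ Zd.connectiveConstant (d + 1) := by
  refine le_ciInf fun n => ?_
  have h0 := Phi_nonneg (Zd.connectiveConstant_nonneg d)
  have h1 := Phi_pow_le_count d (n + 1)
  have hn : ((n : ℝ) + 1) = ((n + 1 : ℕ) : ℝ) := by push_cast; ring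
  calc Phi (Zd.connectiveConstant d)
        = (Phi (Zd.connectiveConstant d) ^ (n + 1)) ^ (1 / ((n : ℝ) + 1)) := by
          rw [hn, one_div, Real.pow_rpow_inv_natCast h0 (Nat.succ_ne_zero n)]
    _ ≤ (Zd.count (d + 1) (n + 1) : ℝ) ^ (1 / ((n : ℝ) + 1)) :=
          Real.rpow_le_rpow (pow_nonneg h0 _) h1 (by positivity)

/-! ### Strictness from Kesten's pattern theorem for `(V, Q)` -/

/-- `baseSite (mk2 a b) = b·e₀` in the base. [folklore] -/
private theorem baseSite_mk2 (a b : ℤ) : baseSite (Zd.mk2 a b : Site (d + 2)) = Pi.single 0 b := by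
  funext j
  simp only [baseSite, Zd.mk2, Pi.add_apply]
  rw [Pi.single_eq_of_ne (Fin.succ_ne_zero j), zero_add]
  by_cases hj : j = 0
  · subst hj
    simp
  · rw [Pi.single_eq_of_ne hj, Pi.single_eq_of_ne]
    rw [Ne, ← Fin.succ_zero_eq_one, Fin.succ_inj]
    exact hj

/-- **No lift contains an occurrence of `(V, Q)`**, `V = N³ESENES³` with `E = +e₀` the fresh direction:
around the points `v(2), …, v(5)` the base walk would step `+e` and then `-e`, revisiting a site.
[cite: MadrasSlade1993, Theorem 7.2.3] -/
theorem not_occV_liftW {n : ℕ} (w : Fin n → Letter) {ω : ℕ → Site (d + 1)}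
    (hω : ω ∈ Zd.saws (d + 1) (hcnt w n)) (k : ℕ) : ¬ Zd.OccV n (liftW w ω) k := by
  rintro ⟨hk, hpat, -⟩
  obtain ⟨-, -, -, hinj⟩ := Zd.mem_saws.1 hω
  have hb : ∀ t ≤ 11, ω (hcnt w (k + t)) = ω (hcnt w k) + Pi.single 0 (Zd.vCoord t).2 := by
    intro t ht
    have := congrArg baseSite (hpat t ht)
    rwa [baseSite_liftW w ω (by omega), baseSite_add, baseSite_liftW w ω (by omega), Zd.vPt,
      baseSite_mk2] at this
  have hh : ∀ t ≤ 11, height w (k + t) = height w k + (Zd.vCoord t).1 := by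
    intro t ht
    have := congrFun (hpat t ht) 0
    rwa [liftW_apply_zero w ω (by omega), Pi.add_apply, liftW_apply_zero w ω (by omega), Zd.vPt,
      Zd.mk2_apply_zero] at this
  have v2 : Zd.vCoord 2 = (0, 2) := rfl
  have v3 : Zd.vCoord 3 = (0, 3) := rfl
  have v4 : Zd.vCoord 4 = (1, 3) := rfl
  have v5 : Zd.vCoord 5 = (1, 2) := rfl
  -- the letters at times k+2, k+3, k+4 are H, U, H
  have l2 : wx w (k + 2) = Letter.H := by
    have e := height_succ w (k + 2)
    rw [show k + 2 + 1 = k + 3 by ring, hh 3 (by norm_num), hh 2 (by norm_num), v2, v3] at e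
    exact Letter.dh_eq_zero_iff.1 (by simpa using e.symm)
  have l3 : wx w (k + 3) = Letter.U := by
    have e := height_succ w (k + 3)
    rw [show k + 3 + 1 = k + 4 by ring, hh 4 (by norm_num), hh 3 (by norm_num), v3, v4] at e
    exact Letter.dh_eq_one_iff.1 (by push_cast at e; linarith)
  have l4 : wx w (k + 4) = Letter.H := by
    have e := height_succ w (k + 4)
    rw [show k + 4 + 1 = k + 5 by ring, hh 5 (by norm_num), hh 4 (by norm_num), v4, v5] at e
    exact Letter.dh_eq_zero_iff.1 (by simpa using e.symm)
  have c3 : hcnt w (k + 3) = hcnt w (k + 2) + 1 := by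
    rw [show k + 3 = k + 2 + 1 by ring, hcnt_succ, l2]; rfl
  have c4 : hcnt w (k + 4) = hcnt w (k + 3) := by
    rw [show k + 4 = k + 3 + 1 by ring, hcnt_succ, l3]; rfl
  have c5 : hcnt w (k + 5) = hcnt w (k + 4) + 1 := by
    rw [show k + 5 = k + 4 + 1 by ring, hcnt_succ, l4]; rfl
  have e25 : ω (hcnt w (k + 2)) = ω (hcnt w (k + 5)) := by
    rw [hb 2 (by norm_num), hb 5 (by norm_num), v2, v5]
  have hle : hcnt w (k + 5) ≤ hcnt w n := hcnt_mono w (by omega)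
  have := hinj (show hcnt w (k + 2) ∈ {i | i ≤ hcnt w n} by simp only [Set.mem_setOf_eq]; omega)
    (show hcnt w (k + 5) ∈ {i | i ≤ hcnt w n} by simpa using hle) e25
  omega

/-- A lift has no `(V, Q)`-occurrence: `J(lift) = 0`. [folklore] -/
private theorem vCount_liftW {n : ℕ} (w : Fin n → Letter) {ω : ℕ → Site (d + 1)}
    (hω : ω ∈ Zd.saws (d + 1) (hcnt w n)) : Zd.vCount n (liftW w ω) = 0 := by
  rw [Zd.vCount, Finset.card_eq_zero, Finset.eq_empty_iff_forall_notMem]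
  intro k hk
  exact not_occV_liftW w hω k (Zd.mem_vSites.1 hk)

/-- **Strict dimension transfer: `Φ(μ(ℤ^{d+1})) < μ(ℤ^{d+2})`** for every `d ≥ 0`, from Kesten's
pattern theorem for `(V, Q)` (`Zd.thm723`, Madras–Slade Theorem 7.2.3; the `ε` is ineffective).
[cite: MadrasSlade1993, Theorem 7.2.3] -/
theorem phi_connectiveConstant_lt (d : ℕ) :
    Phi (Zd.connectiveConstant (d + 1)) < Zd.connectiveConstant (d + 2) := by
  classical
  obtain ⟨q, -, ε, hε0, hε1, N₀, hN⟩ := Zd.thm723 d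
  have hμpos : 0 < Zd.connectiveConstant (d + 2) := Zd.connectiveConstant_pos (d + 2)
  have hA := hN (N₀ + 1) (Nat.le_succ _)
  have hcount : ((∑ w ∈ admWords (N₀ + 1), Zd.count (d + 1) (hcnt w (N₀ + 1)) : ℕ) : ℝ) ≤
      ((1 - ε) * Zd.connectiveConstant (d + 2)) ^ (N₀ + 1) := by
    refine le_trans ?_ hA
    exact_mod_cast sum_count_le_card _ fun w hw ω hω =>
      Finset.mem_filter.2 ⟨liftW_mem_saws (mem_admWords.1 hw) hω, by rw [vCount_liftW w hω]; exact Nat.zero_le _⟩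
  have hΦN : Phi (Zd.connectiveConstant (d + 1)) ^ (N₀ + 1) ≤
      ((1 - ε) * Zd.connectiveConstant (d + 2)) ^ (N₀ + 1) :=
    (Phi_pow_le_G (Zd.connectiveConstant_nonneg _) _).trans
      ((G_connectiveConstant_le_sum (d + 1) _).trans hcount)
  have hΦ : Phi (Zd.connectiveConstant (d + 1)) ≤ (1 - ε) * Zd.connectiveConstant (d + 2) :=
    le_of_pow_le_pow_left₀ (Nat.succ_ne_zero N₀) (by nlinarith) hΦN
  calc Phi (Zd.connectiveConstant (d + 1)) ≤ (1 - ε) * Zd.connectiveConstant (d + 2) := hΦ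
    _ < Zd.connectiveConstant (d + 2) := by nlinarith

/-! ### Corollaries: the gap between consecutive dimensions -/

/-- **`μ(ℤ^{d+1}) - μ(ℤ^d) > 2 - 2/(μ(ℤ^d) + 2)`** for `d ≥ 1`. [cite: MadrasSlade1993, §1.2, eq. (1.2.2)] -/
theorem gap_gt (d : ℕ) [NeZero d] :
    2 - 2 / (Zd.connectiveConstant d + 2) < Zd.connectiveConstant (d + 1) - Zd.connectiveConstant d := by
  have h1 := phi_connectiveConstant_le d
  have h2 := two_sub_lt_Phi_sub (Zd.connectiveConstant_pos d)
  linarith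

/-- **`μ(ℤ^{d+1}) - μ(ℤ^d) > 2 - 2/(d + 2)`** for `d ≥ 1` (with the tree's `μ(d) ≥ d`); the right side
increases to `2`. [cite: MadrasSlade1993, §1.2, eq. (1.2.2)] -/
theorem gap_gt_natCast (d : ℕ) [NeZero d] :
    2 - 2 / ((d : ℝ) + 2) < Zd.connectiveConstant (d + 1) - Zd.connectiveConstant d := by
  have hd : (d : ℝ) ≤ Zd.connectiveConstant d := Zd.natCast_le_connectiveConstant d
  have h0 : (0 : ℝ) < (d : ℝ) + 2 := by positivity
  have : 2 - 2 / ((d : ℝ) + 2) ≤ 2 - 2 / (Zd.connectiveConstant d + 2) := by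
    have : 2 / (Zd.connectiveConstant d + 2) ≤ 2 / ((d : ℝ) + 2) := by
      gcongr
    linarith
  exact this.trans_lt (gap_gt d)

/-! ### Numerical instances (STRUCTURAL, NOT RECORDS) -/

/-- **Temperley's bound `μ(ℤ²) ≥ 1 + √2`** (the case `d = 1`: the lifts of the two directed half-lines of
`ℤ¹` are the partially directed self-avoiding walks of `ℤ²`, whose growth constant is `1 + √2`;
Temperley 1956). "lim_{n→∞} n⁻¹ log uₙ = log(1+√2)". [cite: Jansevanrensburg2015, eq. (4.197)] -/
theorem one_add_sqrt_two_le_connectiveConstant_two :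
    1 + Real.sqrt 2 ≤ Zd.connectiveConstant 2 := by
  have h1 : (1 : ℝ) ≤ Zd.connectiveConstant 1 := Zd.one_le_connectiveConstant 1
  have hΦ := phi_connectiveConstant_le 1
  have hmono := Phi_le_Phi zero_le_one h1
  have hΦ1 : Phi 1 = 1 + Real.sqrt 2 := by
    unfold Phi
    have : Real.sqrt ((1 : ℝ) ^ 2 + 6 * 1 + 1) = 2 * Real.sqrt 2 := by
      rw [show (1 : ℝ) ^ 2 + 6 * 1 + 1 = 2 ^ 2 * 2 by norm_num, Real.sqrt_mul (by norm_num),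
        Real.sqrt_sq (by norm_num)]
    rw [this]
    ring
  linarith

/-- **`μ(ℤ³) ≥ 4.24425`** from the PRINTED `μ(ℤ²) ≥ 2.625622` (Jensen 2004, via the named fact
`Zd.BDGS2012_connectiveConstant_two_bounds`, taken as a hypothesis) and `Φ(2.625622) ≥ 4.24425`.
STRUCTURAL, NOT A RECORD: printed `μ(ℤ³) ≥ 4.572140` (Hara–Slade–Sokal 1993). [cite: BDGS2012, §1.3, eq. (1.14)] -/
theorem connectiveConstant_three_ge_of_two_bounds (h : Zd.BDGS2012_connectiveConstant_two_bounds) :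
    (4.24425 : ℝ) ≤ Zd.connectiveConstant 3 := by
  have hΦ := phi_connectiveConstant_le 2
  have hmono := Phi_le_Phi (by norm_num) h.1
  have hnum : (4.24425 : ℝ) ≤ Phi 2.625622 := by
    unfold Phi
    have : (4.862878 : ℝ) ≤ Real.sqrt ((2.625622 : ℝ) ^ 2 + 6 * 2.625622 + 1) := by
      rw [Real.le_sqrt (by norm_num) (by norm_num)]
      norm_num
    linarith
  linarith

end Literature.Probability.RandomPlanarGeometry.SAW.Zd.DimTransfer
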